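import Summits.CriticalPhenomena.PercolationContinuityZ3.Theorems.PercNearOneGluingNoHeavyLowerTailSahiLatinMoves4

/-!
# `NoHeavyLowerTail` (crux stmt-CriticalPhenomena-4575), Sahi programme (prim-master-conj gen 46): **CHARGE MONOTONICITY AT ORDER 4** —
# for up-sets `b, c, d ⊆ [4]^ι` the order-4 charge `Φ⁴_{bcd}` is NON-DECREASING on the triple meet `b ∩ c ∩ d` (every dimension)

Support file (`--supports stmt-CriticalPhenomena-4575`; companion of `…SahiLatinKernel4/Moves4` (gen 42) and of the order-3 files
`…SahiLatinChargeMonotone`, `…SahiLatinReflection` (this gen); memo `run/shared/lean/prim/prim-l12/FROM-prim-master-conj-g46-CHARGE-MONOTONICITY.md` §5).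

THE MATHEMATICS (all `d`; everything PROVED, axioms standard).  `Φ⁴_{bcd}(u)` is the coefficient of `[u ∈ a]` in the order-4 kernel
`K₄(a,b,c,d)` (`kappa4_eq_sum_Phi4`); `pull4 u s ⊆ [3]^ι` is the trace of `s` on the link of `u`, pulled back along the monotone link embedding
`emb u` (`…SahiLatinKernel4`).
* `avoid2`, `avoid3` and their sum forms: `L − S1 s − S1 t + latinPairs s t = #{X ∉ s, Y ∉ t}` and the empty-corner functional
  `E₁(s,t,v) = #{X ∉ s, Y ∉ t, Z ∉ v}` are ANTITONE in their set arguments (`avoid2_anti`, `avoid3_anti`), as is `L − S1 s`.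
* **TOP-CELL FORM** `Phi4_top_eq`: for `u ∈ b ∩ c ∩ d`, with `b' = pull4 u b` etc.,
  `Φ⁴_{bcd}(u) = E₁(b',c',d') + A₂(b'∩c', d') + A₂(b'∩d', c') + A₂(c'∩d', b') + 2·(L − S1(b'∩c'∩d'))`
  — the order-4 case of the top-cell identity (gen 41 memo §10c: `φ/L = Σ_{π} Π_B (|B|−1)! · E[Π_B (1 − f_B(P_B))]`), a positive combination of
  avoidance probabilities of the link traces (regrouping of `Phi4_eq_functionals`).
* `succAbove_anti`, `emb_anti`, **`pull4_anti`**: raising the base point `u ≤ u'` SHRINKS the pulled-back traces of an up-set (`pull4 u' s ⊆ pull4 u s`),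
  because the `j`-th level of the link of `u'` is at most the `j`-th level of the link of `u` on every axis.
* **`Phi4_mono_of_mem_inter`**: for up-sets `b, c, d` and `u ≤ u'` with `u ∈ b ∩ c ∩ d`: `Φ⁴_{bcd}(u) ≤ Φ⁴_{bcd}(u')`.
The same two-line argument (top-cell identity + trace shrinking) proves charge monotonicity at EVERY order `n` on `[n]^D` (memo §5, paper;
numerically: order 4 on `[4]^2` exhaustive — 1 460 832 comparable pairs —, `[4]^3` sampled; order 5 on `[5]^1`, `[5]^2` sampled; 0 violations).
HONEST LABEL: structure theorem; FBP(4,D ≥ 4), FBP(3,d ≥ 5), Sahi's `C₄`/`C₃` and Kahn's conjecture remain OPEN. [this work]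
-/

namespace Summit.CriticalPhenomena.PercolationContinuityZ3.Theorems.SahiLatin

open Finset

variable {ι : Type*} [Fintype ι] [DecidableEq ι]

/-! ## §1  Avoidance functionals and their antitonicity -/

/-- `A₂(s,t) = L − S1 s − S1 t + latinPairs s t` is the number of Latin triples with `X ∉ s, Y ∉ t`. [this work] -/
theorem avoid2_eq_sum (s t : Finset (Pt ι)) :
    Lnum ι - S1 s - S1 t + latinPairs s t = ∑ σ : LPerm ι, (1 - ind s (lpt σ 0)) * (1 - ind t (lpt σ 1)) := by
  have hL : Lnum ι = ∑ _σ : LPerm ι, (1 : ℤ) := by simp [Lnum]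
  rw [hL, S1, ← sum_ind_one t, latinPairs]
  simp only [← sum_sub_distrib, ← sum_add_distrib]
  exact sum_congr rfl fun σ _ => by ring

/-- `E₁(s,t,v) = L − S1 s − S1 t − S1 v + latinPairs s t + latinPairs s v + latinPairs t v − latinTriples s t v` is the number of Latin
triples with `X ∉ s, Y ∉ t, Z ∉ v`. [this work] -/
theorem avoid3_eq_sum (s t v : Finset (Pt ι)) :
    Lnum ι - S1 s - S1 t - S1 v + latinPairs s t + latinPairs s v + latinPairs t v - latinTriples s t v =
      ∑ σ : LPerm ι, (1 - ind s (lpt σ 0)) * (1 - ind t (lpt σ 1)) * (1 - ind v (lpt σ 2)) := by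
  have hL : Lnum ι = ∑ _σ : LPerm ι, (1 : ℤ) := by simp [Lnum]
  rw [hL, S1, ← sum_ind_one t, ← sum_ind_two v, latinPairs, ← sum_pair02 s v, ← sum_pair12 t v, latinTriples]
  simp only [← sum_sub_distrib, ← sum_add_distrib]
  exact sum_congr rfl fun σ _ => by ring

/-- `ind` is monotone in the set. [this work] -/
theorem ind_mono {β : Type*} [DecidableEq β] {s S : Finset β} (h : s ⊆ S) (x : β) : ind s x ≤ ind S x := by
  by_cases hx : x ∈ s
  · rw [ind_of_mem hx, ind_of_mem (h hx)]
  · rw [ind_of_not_mem hx]; exact ind_nonneg S x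

/-- `L − S1 s` is antitone in `s`. [this work] -/
theorem S1_mono {s S : Finset (Pt ι)} (h : s ⊆ S) : S1 s ≤ S1 S := by
  unfold S1
  exact sum_le_sum fun σ _ => ind_mono h _

/-- **`A₂` is antitone**: enlarging the sets can only decrease `#{X ∉ s, Y ∉ t}`. [this work] -/
theorem avoid2_anti {s S t T : Finset (Pt ι)} (hs : s ⊆ S) (ht : t ⊆ T) :
    Lnum ι - S1 S - S1 T + latinPairs S T ≤ Lnum ι - S1 s - S1 t + latinPairs s t := by
  rw [avoid2_eq_sum, avoid2_eq_sum]
  refine sum_le_sum fun σ _ => ?_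
  have h1 := ind_mono hs (lpt σ 0)
  have h2 := ind_mono ht (lpt σ 1)
  have u1 := ind_le_one S (lpt σ 0)
  have u2 := ind_le_one T (lpt σ 1)
  have l1 := ind_nonneg s (lpt σ 0)
  have l2 := ind_nonneg t (lpt σ 1)
  nlinarith

/-- **`E₁` is antitone**: enlarging the sets can only decrease `#{X ∉ s, Y ∉ t, Z ∉ v}`. [this work] -/
theorem avoid3_anti {s S t T v V : Finset (Pt ι)} (hs : s ⊆ S) (ht : t ⊆ T) (hv : v ⊆ V) :
    Lnum ι - S1 S - S1 T - S1 V + latinPairs S T + latinPairs S V + latinPairs T V - latinTriples S T V ≤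
      Lnum ι - S1 s - S1 t - S1 v + latinPairs s t + latinPairs s v + latinPairs t v - latinTriples s t v := by
  rw [avoid3_eq_sum, avoid3_eq_sum]
  refine sum_le_sum fun σ _ => ?_
  have h1 := ind_mono hs (lpt σ 0)
  have h2 := ind_mono ht (lpt σ 1)
  have h3 := ind_mono hv (lpt σ 2)
  have u1 := ind_le_one S (lpt σ 0)
  have u2 := ind_le_one T (lpt σ 1)
  have u3 := ind_le_one V (lpt σ 2)
  have l1 := ind_nonneg s (lpt σ 0)
  have l2 := ind_nonneg t (lpt σ 1)
  have l3 := ind_nonneg v (lpt σ 2)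
  -- (1-a')(1-b')(1-c') ≤ (1-a)(1-b)(1-c) for 0 ≤ a ≤ a' ≤ 1 etc.
  have e1 : (1 - ind S (lpt σ 0)) * (1 - ind T (lpt σ 1)) ≤ (1 - ind s (lpt σ 0)) * (1 - ind t (lpt σ 1)) := by nlinarith
  have e2 : 0 ≤ (1 - ind S (lpt σ 0)) * (1 - ind T (lpt σ 1)) := by nlinarith
  calc (1 - ind S (lpt σ 0)) * (1 - ind T (lpt σ 1)) * (1 - ind V (lpt σ 2))
      ≤ (1 - ind S (lpt σ 0)) * (1 - ind T (lpt σ 1)) * (1 - ind v (lpt σ 2)) := by nlinarith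
    _ ≤ (1 - ind s (lpt σ 0)) * (1 - ind t (lpt σ 1)) * (1 - ind v (lpt σ 2)) := by nlinarith

/-! ## §2  The top-cell form of the order-4 charge -/

/-- **TOP-CELL FORM** (all `ι`): for `u ∈ b ∩ c ∩ d`, with `b' = pull4 u b` etc.,
`Φ⁴_{bcd}(u) = E₁(b',c',d') + A₂(b'∩c',d') + A₂(b'∩d',c') + A₂(c'∩d',b') + 2(L − S1(b'∩c'∩d'))` — a positive combination of avoidance
counts of the link traces (order-4 case of the top-cell identity). [this work] -/
theorem Phi4_top_eq {b c d : Finset (Pt4 ι)} {u : Pt4 ι} (hb : u ∈ b) (hc : u ∈ c) (hd : u ∈ d) :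
    Phi4 b c d u =
      (Lnum ι - S1 (pull4 u b) - S1 (pull4 u c) - S1 (pull4 u d) + latinPairs (pull4 u b) (pull4 u c)
          + latinPairs (pull4 u b) (pull4 u d) + latinPairs (pull4 u c) (pull4 u d) - latinTriples (pull4 u b) (pull4 u c) (pull4 u d))
      + (Lnum ι - S1 (pull4 u b ∩ pull4 u c) - S1 (pull4 u d) + latinPairs (pull4 u b ∩ pull4 u c) (pull4 u d))
      + (Lnum ι - S1 (pull4 u b ∩ pull4 u d) - S1 (pull4 u c) + latinPairs (pull4 u b ∩ pull4 u d) (pull4 u c))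
      + (Lnum ι - S1 (pull4 u c ∩ pull4 u d) - S1 (pull4 u b) + latinPairs (pull4 u c ∩ pull4 u d) (pull4 u b))
      + 2 * (Lnum ι - S1 (pull4 u b ∩ pull4 u c ∩ pull4 u d)) := by
  rw [Phi4_eq_functionals, ind_of_mem hb, ind_of_mem hc, ind_of_mem hd]
  ring

/-! ## §3  Raising the base point shrinks the traces -/

/-- `Fin.succAbove` is antitone in the pivot (finite check on `Fin 4`, `Fin 3`). [this work] -/
theorem succAbove_anti : ∀ (p p' : Fin 4), p ≤ p' → ∀ j : Fin 3, p'.succAbove j ≤ p.succAbove j := by decide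

omit [Fintype ι] [DecidableEq ι] in
/-- The link embedding is antitone in the base point. [this work] -/
theorem emb_anti {u u' : Pt4 ι} (h : u ≤ u') (q : Pt ι) : emb u' q ≤ emb u q :=
  fun i => succAbove_anti (u i) (u' i) (h i) (q i)

/-- **Raising the base point shrinks the pulled-back trace of an up-set.** [this work] -/
theorem pull4_anti {u u' : Pt4 ι} (h : u ≤ u') {s : Finset (Pt4 ι)} (hs : IsUpperSet (s : Set (Pt4 ι))) :
    pull4 u' s ⊆ pull4 u s := by
  intro q hq
  rw [mem_pull4] at hq ⊢
  exact hs (emb_anti h q) hq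

/-! ## §4  CHARGE MONOTONICITY at order 4 -/

/-- **CHARGE MONOTONICITY AT ORDER 4** (all `ι`): for up-sets `b, c, d ⊆ [4]^ι` and `u ≤ u'` with `u ∈ b ∩ c ∩ d`,
`Φ⁴_{bcd}(u) ≤ Φ⁴_{bcd}(u')`. [this work] -/
theorem Phi4_mono_of_mem_inter {b c d : Finset (Pt4 ι)} (hb : IsUpperSet (b : Set (Pt4 ι))) (hc : IsUpperSet (c : Set (Pt4 ι)))
    (hd : IsUpperSet (d : Set (Pt4 ι))) {u u' : Pt4 ι} (huu : u ≤ u') (hub : u ∈ b) (huc : u ∈ c) (hud : u ∈ d) :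
    Phi4 b c d u ≤ Phi4 b c d u' := by
  have hub' : u' ∈ b := hb huu hub
  have huc' : u' ∈ c := hc huu huc
  have hud' : u' ∈ d := hd huu hud
  rw [Phi4_top_eq hub huc hud, Phi4_top_eq hub' huc' hud']
  have sb := pull4_anti huu hb
  have sc := pull4_anti huu hc
  have sd := pull4_anti huu hd
  have e1 := avoid3_anti (ι := ι) sb sc sd
  have e2 := avoid2_anti (ι := ι) (inter_subset_inter sb sc) sd
  have e3 := avoid2_anti (ι := ι) (inter_subset_inter sb sd) sc
  have e4 := avoid2_anti (ι := ι) (inter_subset_inter sc sd) sb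
  have e5 := S1_mono (ι := ι) (inter_subset_inter (inter_subset_inter sb sc) sd)
  linarith

end Summit.CriticalPhenomena.PercolationContinuityZ3.Theorems.SahiLatin
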